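/-
Planner work file (lens «negation» at crux level, generation 17) for the crux
`KrwChromaticSteering.StrongComposition` (C1, stmt-PneNP-18538), route `route-PneNP-KrwChromaticSteering`.
Seat pnp-ideate-p5 (g17), 2026-08-28.  Sorry-free.  Published with
`ledger crux write stmt-PneNP-18538 LensNegationP5g17.lean`.
FRONTIER (formula-depth / KRW rung); nothing here bears on P vs NP.
-/
import Mathlib
import Summits.PneNP.PneNP.Cruxes.StrongComposition.Disproof
import Literature.Computability.Complexity.KWDepthHardFunctions

/-!
# Negation lens on `StrongComposition` (C1), generation 17: WHERE a counterexample must live —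
label-public separable protocols are compose-optimal, and private steering with `K` types buys
`≤ 2⌈log₂ K⌉ + 2` rounds (kernel-checked)

The negation lens asks us to BUILD a protocol for the strong composition game `KW_f ⊛ KW_g` that beats
the obvious protocol by `ω(log mn)` rounds (a counterexample to C1), and — failing that — to TYPE the
obstruction.  No construction survived (memo `LensNegationP5g17.md` §1 lists the attempts with the exact
failing step).  This file proves the obstruction for the protocol class in which every attempted savings
mechanism of generations 16–17 lives, and its quantitative extension to label-private steering:

**Definition (`LabelPublic g P`; relativised `LabelPublicOn g 𝒜 ℬ P`).**  A protocol tree `P` over matrix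
entries is LABEL-PUBLIC SEPARABLE (w.r.t. the inner `g`) if the bit sent at every node is EITHER a
function of the sender's label column `g(X) = (g(X_1),…,g(X_m))` alone (a "label test"), OR a function of
ONE row `X_i` of the sender's matrix alone, the row index `i` AND the test being fixed at the node (a
"public row test": which row is probed, and how, may depend on everything said so far, but NOT privately
on the sender's labels).  The obvious protocol `KWTree.compose` is label-public separable
(`labelPublic_compose`).  `TypedSep g τA τB P` (`τA, τB : labels → Fin K`) is the label-PRIVATE
extension: row index and row test may depend on the sender's labels through a `K`-valued type.

**Theorem M3 (`exists_solves_of_labelPublic`; rectangle form `labelPublicOn_rect_bound`).**  For all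
non-constant `f`, `g`, every label-public separable `P` solving `KW_f ⊛ KW_g`, and every `dg` below the
`KW_g`-depth of `g`, there is a `KW_f`-protocol `Q` with `Q.depth + dg ≤ P.depth + 2`.  In words:
`D(P) ≥ D(KW_f) + D(KW_g) − 2` — NO label-public separable protocol saves more than two rounds over
INDEPENDENT play, for EVERY inner `g` (not just for most), with NO `log(mn)` slack; tight up to three
rounds (`depth_compose`).

**Corollary (`strongComposition_labelPublic`).**  C1 VERBATIM with the single extra hypothesis
`LabelPublic g P` holds (constant `c = c₀ + 2`, `c₀` the Riordan–Shannon constant of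
`DepthHardFunctionsExist_holds`).

**Theorem M3-typed (`typedSep_rect_bound`).**  A `K`-typed separable protocol is compose-optimal on EVERY
type rectangle: `C((f⁻¹1 ∩ τA⁻¹t) × (f⁻¹0 ∩ τB⁻¹t')) + D(KW_g) ≤ D(P) + 2` for all `t, t'`.  As
`D(KW_f) ≤ 2⌈log₂ K⌉ + max_{t,t'} C(type rectangle)` (announce the types), private single-row steering
with `K` types per player saves `≤ 2⌈log₂ K⌉ + 2` rounds.

**Consequence for the negation lens (memo §3–§4).**  A counterexample to C1 must, on inputs no bounded
type refinement avoids, EITHER steer its single-row tests by `(mn)^{ω(1)}` effective label types per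
player (label-private steering in the strong sense), OR use tests mixing several rows.  Every savings
gadget tried in g16/g17 (amortised row identification, prepaid/speculative row progress, shared row
encodings, the 2-bit drift gadget) is typed-separable with `K = O(1)` — dead by these theorems — or is a
multi-row encoding for which the memo records why no savings were found; the cheapest undecided instance
is named there (§4).

PROOF (adversary / potential, Karchmer–Wigderson style; section `Key`).  Along a root–leaf path the
adversary maintains a label rectangle `A × B` and, for every row `i`, row sets `S_i, T_i`; the potential is
`ℓ + K` where `ℓ` lower-bounds the KW-depth of the REALISABLE label rectangle and `K` lower-bounds, for
every still-possible final orientation `(i, α)` (`a_i = α`, `b_i = ¬α`), the KW-depth of the row game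
`(S_i ∩ g⁻¹α) × (T_i ∩ g⁻¹¬α)` plus the number of sides already constant at coordinate `i`.  A label test
costs `ℓ` at most one (one-bit subadditivity, `Hard.split_alice/bob`); a public row test on row `i` either
leaves every realisable orientation of row `i` undamaged in one child (then only `K` drops by one), or
FORKS (each child damages some realisable orientation) — then the adversary itself fixes the sender's
label `a_i` (`ℓ` drops by at most one, subadditivity again) and follows the child undamaged for the
surviving orientation, whose count `damage − 1 + (newly constant side) + 1` is unchanged.  At a leaf
`(i, j)` both remaining games are solved by leaves, so `ℓ + K ≤ 2`.  Lower bounds are carried as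
predicates `Hard A B ℓ` ("every solver has depth ≥ ℓ"), so no `sInf` bookkeeping is needed.

What this file does NOT do: it does not touch label-private steering with unboundedly many types beyond
the `2⌈log₂ K⌉ + 2` accounting, nor multi-row tests (the two residual classes), and it does not bear on
`P ≠ NP`; C1 itself stays open.
-/

set_option linter.dupNamespace false
set_option autoImplicit false

namespace Summit.PneNP.PneNP.Cruxes.StrongComposition.LabelPublic

open Literature.Computability.Complexity
open Summit.PneNP.PneNP.Theses.KrwChromaticSteering (StrongComposition)
open Summit.PneNP.PneNP.Cruxes.StrongComposition.Disproof (one_le_of_nonconst exists_solves_sendInput)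

universe u

/-! ## §1  Rectangles: solving, hardness, one-bit subadditivity -/

section Rect

variable {ι : Type u}

/-- `SolvesRect Q A B`: the tree `Q` solves the Karchmer–Wigderson game on the rectangle `A × B`. -/
def SolvesRect (Q : KWTree ι) (A B : Set (ι → Bool)) : Prop :=
  ∀ a ∈ A, ∀ b ∈ B, a (Q.run a b) ≠ b (Q.run a b)

/-- `Hard A B ℓ`: every tree solving the rectangle `A × B` has depth `≥ ℓ` (a lower bound on `C(A × B)`,
stated without `sInf`). -/
def Hard (A B : Set (ι → Bool)) (ℓ : ℕ) : Prop :=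
  ∀ Q : KWTree ι, SolvesRect Q A B → ℓ ≤ Q.depth

theorem SolvesRect.mono {Q : KWTree ι} {A A' B B' : Set (ι → Bool)} (h : SolvesRect Q A B)
    (hA : A' ⊆ A) (hB : B' ⊆ B) : SolvesRect Q A' B' :=
  fun a ha b hb => h a (hA ha) b (hB hb)

theorem Hard.mono {A A' B B' : Set (ι → Bool)} {ℓ : ℕ} (h : Hard A B ℓ) (hA : A ⊆ A') (hB : B ⊆ B') :
    Hard A' B' ℓ :=
  fun Q hQ => h Q (hQ.mono hA hB)

theorem Hard.of_le {A B : Set (ι → Bool)} {ℓ ℓ' : ℕ} (h : Hard A B ℓ) (hℓ : ℓ' ≤ ℓ) : Hard A B ℓ' :=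
  fun Q hQ => hℓ.trans (h Q hQ)

theorem hard_zero (A B : Set (ι → Bool)) : Hard A B 0 := fun _ _ => Nat.zero_le _

/-- A rectangle solved by a leaf has no positive lower bound. -/
theorem Hard.eq_zero_of_leaf {A B : Set (ι → Bool)} {ℓ : ℕ} (h : Hard A B ℓ) {i : ι}
    (hi : SolvesRect (KWTree.leaf i) A B) : ℓ = 0 := by
  have := h _ hi
  simpa using this

/-- A hard rectangle (`ℓ ≥ 1`) has a nonempty Alice side (given any coordinate to name). -/
theorem Hard.nonempty_left {A B : Set (ι → Bool)} {ℓ : ℕ} (h : Hard A B ℓ) (hℓ : 1 ≤ ℓ) (i : ι) :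
    A.Nonempty := by
  by_contra hA
  rw [Set.not_nonempty_iff_eq_empty] at hA
  have h0 : ℓ = 0 := h.eq_zero_of_leaf (i := i) (by intro a ha; simp [hA] at ha)
  omega

theorem Hard.nonempty_right {A B : Set (ι → Bool)} {ℓ : ℕ} (h : Hard A B ℓ) (hℓ : 1 ≤ ℓ) (i : ι) :
    B.Nonempty := by
  by_contra hB
  rw [Set.not_nonempty_iff_eq_empty] at hB
  have h0 : ℓ = 0 := h.eq_zero_of_leaf (i := i) (by intro a ha b hb; simp [hB] at hb)
  omega

/-- **One-bit subadditivity, Alice side.**  If `A × B` needs depth `ℓ` and Alice's side is cut in two by a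
bit `φ`, one of the two parts is nonempty and still needs depth `ℓ − 1` (else glue the two cheap trees under
an Alice node). -/
theorem Hard.split_alice {A B : Set (ι → Bool)} {ℓ : ℕ} (h : Hard A B ℓ) (hA : A.Nonempty) (i₀ : ι)
    (φ : (ι → Bool) → Bool) :
    ∃ β : Bool, (A ∩ {a | φ a = β}).Nonempty ∧ Hard (A ∩ {a | φ a = β}) B (ℓ - 1) := by
  classical
  by_cases hℓ : ℓ ≤ 1
  · obtain ⟨a, ha⟩ := hA
    refine ⟨φ a, ⟨a, ha, rfl⟩, ?_⟩
    have : ℓ - 1 = 0 := by omega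
    rw [this]
    exact hard_zero _ _
  · have key : ∃ β : Bool, Hard (A ∩ {a | φ a = β}) B (ℓ - 1) := by
      by_contra hcon
      push Not at hcon
      have h0 := hcon false
      have h1 := hcon true
      simp only [Hard, not_forall, not_le] at h0 h1
      obtain ⟨Q0, hQ0, hd0⟩ := h0
      obtain ⟨Q1, hQ1, hd1⟩ := h1
      have hsol : SolvesRect (KWTree.alice φ Q0 Q1) A B := by
        intro a ha b hb
        by_cases hφ : φ a = true
        · simp only [KWTree.run_alice, hφ, if_true]
          exact hQ1 a ⟨ha, hφ⟩ b hb
        · simp only [KWTree.run_alice, hφ]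
          exact hQ0 a ⟨ha, by simpa using hφ⟩ b hb
      have := h _ hsol
      simp only [KWTree.depth_alice] at this
      omega
    obtain ⟨β, hβ⟩ := key
    exact ⟨β, hβ.nonempty_left (by omega) i₀, hβ⟩

/-- **One-bit subadditivity, Bob side.** -/
theorem Hard.split_bob {A B : Set (ι → Bool)} {ℓ : ℕ} (h : Hard A B ℓ) (hB : B.Nonempty) (i₀ : ι)
    (φ : (ι → Bool) → Bool) :
    ∃ β : Bool, (B ∩ {b | φ b = β}).Nonempty ∧ Hard A (B ∩ {b | φ b = β}) (ℓ - 1) := by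
  classical
  by_cases hℓ : ℓ ≤ 1
  · obtain ⟨b, hb⟩ := hB
    refine ⟨φ b, ⟨b, hb, rfl⟩, ?_⟩
    have : ℓ - 1 = 0 := by omega
    rw [this]
    exact hard_zero _ _
  · have key : ∃ β : Bool, Hard A (B ∩ {b | φ b = β}) (ℓ - 1) := by
      by_contra hcon
      push Not at hcon
      have h0 := hcon false
      have h1 := hcon true
      simp only [Hard, not_forall, not_le] at h0 h1
      obtain ⟨Q0, hQ0, hd0⟩ := h0
      obtain ⟨Q1, hQ1, hd1⟩ := h1
      have hsol : SolvesRect (KWTree.bob φ Q0 Q1) A B := by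
        intro a ha b hb
        by_cases hφ : φ b = true
        · simp only [KWTree.run_bob, hφ, if_true]
          exact hQ1 a ha b ⟨hb, hφ⟩
        · simp only [KWTree.run_bob, hφ]
          exact hQ0 a ha b ⟨hb, by simpa using hφ⟩
      have := h _ hsol
      simp only [KWTree.depth_bob] at this
      omega
    obtain ⟨β, hβ⟩ := key
    exact ⟨β, hβ.nonempty_right (by omega) i₀, hβ⟩

/-- Hardness of the role-swapped rectangle. -/
theorem Hard.swap {A B : Set (ι → Bool)} {ℓ : ℕ} (h : Hard A B ℓ) : Hard B A ℓ := by
  intro Q hQ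
  have hsol : SolvesRect Q.swap A B := by
    intro a ha b hb
    rw [KWTree.run_swap]
    exact fun h' => hQ b hb a ha h'.symm
  simpa using h _ hsol

end Rect

/-! ## §2  The strong composition game seen by the adversary: states, realisable labels, row games -/

section Game

variable {m n : ℕ}

/-- The matrix with rows `x 0, …, x (m-1)`. -/
def ofRows (x : Fin m → Fin n → Bool) : Fin m × Fin n → Bool := fun p => x p.1 p.2

@[simp] theorem ofRows_apply (x : Fin m → Fin n → Bool) (i : Fin m) (j : Fin n) :
    ofRows x (i, j) = x i j := rfl

@[simp] theorem row_ofRows (x : Fin m → Fin n → Bool) (i : Fin m) : row (ofRows x) i = x i := rfl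

/-- Replace row `i` of `X` by `x`. -/
def setRow (X : Fin m × Fin n → Bool) (i : Fin m) (x : Fin n → Bool) : Fin m × Fin n → Bool :=
  fun p => if p.1 = i then x p.2 else X p

theorem setRow_apply (X : Fin m × Fin n → Bool) (i : Fin m) (x : Fin n → Bool) (p : Fin m × Fin n) :
    setRow X i x p = if p.1 = i then x p.2 else X p := rfl

@[simp] theorem row_setRow_self (X : Fin m × Fin n → Bool) (i : Fin m) (x : Fin n → Bool) :
    row (setRow X i x) i = x := by
  funext j; simp [row, setRow]

theorem row_setRow_of_ne (X : Fin m × Fin n → Bool) {i i' : Fin m} (x : Fin n → Bool) (h : i' ≠ i) :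
    row (setRow X i x) i' = row X i' := by
  funext j; simp [row, setRow, h]

/-- **Label-public separable protocols** (w.r.t. the inner function `g`): every node's bit is a function
of the sender's label column `g(X)` alone, or of ONE row `X_i` alone with `i` fixed at the node. -/
def LabelPublic (g : (Fin n → Bool) → Bool) : KWTree (Fin m × Fin n) → Prop
  | .leaf _ => True
  | .alice s P Q =>
      ((∃ φ : (Fin m → Bool) → Bool, ∀ X, s X = φ (rowLabels g X)) ∨
        (∃ (i : Fin m) (ψ : (Fin n → Bool) → Bool), ∀ X, s X = ψ (row X i))) ∧
      LabelPublic g P ∧ LabelPublic g Q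
  | .bob s P Q =>
      ((∃ φ : (Fin m → Bool) → Bool, ∀ Y, s Y = φ (rowLabels g Y)) ∨
        (∃ (i : Fin m) (ψ : (Fin n → Bool) → Bool), ∀ Y, s Y = ψ (row Y i))) ∧
      LabelPublic g P ∧ LabelPublic g Q

/-- Relativised separability `LabelPublicOn g 𝒜 ℬ P`: the tests need only be label tests / public row
tests on the label columns in `𝒜` (Alice nodes) resp. `ℬ` (Bob nodes).  `LabelPublic` is the case
`𝒜 = ℬ = univ` (`LabelPublic.on`); a `K`-typed protocol is label-public on every type rectangle
(`TypedSep.labelPublicOn`). -/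
def LabelPublicOn (g : (Fin n → Bool) → Bool) (𝒜 ℬ : Set (Fin m → Bool)) : KWTree (Fin m × Fin n) → Prop
  | .leaf _ => True
  | .alice s P Q =>
      ((∃ φ : (Fin m → Bool) → Bool, ∀ X, rowLabels g X ∈ 𝒜 → s X = φ (rowLabels g X)) ∨
        (∃ (i : Fin m) (ψ : (Fin n → Bool) → Bool), ∀ X, rowLabels g X ∈ 𝒜 → s X = ψ (row X i))) ∧
      LabelPublicOn g 𝒜 ℬ P ∧ LabelPublicOn g 𝒜 ℬ Q
  | .bob s P Q =>
      ((∃ φ : (Fin m → Bool) → Bool, ∀ Y, rowLabels g Y ∈ ℬ → s Y = φ (rowLabels g Y)) ∨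
        (∃ (i : Fin m) (ψ : (Fin n → Bool) → Bool), ∀ Y, rowLabels g Y ∈ ℬ → s Y = ψ (row Y i))) ∧
      LabelPublicOn g 𝒜 ℬ P ∧ LabelPublicOn g 𝒜 ℬ Q

theorem LabelPublic.on {g : (Fin n → Bool) → Bool} (𝒜 ℬ : Set (Fin m → Bool)) :
    ∀ {P : KWTree (Fin m × Fin n)}, LabelPublic g P → LabelPublicOn g 𝒜 ℬ P
  | .leaf _, _ => trivial
  | .alice s P Q, h => by
    have h' : ((∃ φ : (Fin m → Bool) → Bool, ∀ X, s X = φ (rowLabels g X)) ∨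
        (∃ (i : Fin m) (ψ : (Fin n → Bool) → Bool), ∀ X, s X = ψ (row X i))) ∧
      LabelPublic g P ∧ LabelPublic g Q := h
    obtain ⟨hs, hP, hQ⟩ := h'
    show (_ ∨ _) ∧ _ ∧ _
    refine ⟨?_, LabelPublic.on 𝒜 ℬ hP, LabelPublic.on 𝒜 ℬ hQ⟩
    rcases hs with ⟨φ, hφ⟩ | ⟨i, ψ, hψ⟩
    · exact Or.inl ⟨φ, fun X _ => hφ X⟩
    · exact Or.inr ⟨i, ψ, fun X _ => hψ X⟩
  | .bob s P Q, h => by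
    have h' : ((∃ φ : (Fin m → Bool) → Bool, ∀ Y, s Y = φ (rowLabels g Y)) ∨
        (∃ (i : Fin m) (ψ : (Fin n → Bool) → Bool), ∀ Y, s Y = ψ (row Y i))) ∧
      LabelPublic g P ∧ LabelPublic g Q := h
    obtain ⟨hs, hP, hQ⟩ := h'
    show (_ ∨ _) ∧ _ ∧ _
    refine ⟨?_, LabelPublic.on 𝒜 ℬ hP, LabelPublic.on 𝒜 ℬ hQ⟩
    rcases hs with ⟨φ, hφ⟩ | ⟨i, ψ, hψ⟩
    · exact Or.inl ⟨φ, fun Y _ => hφ Y⟩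
    · exact Or.inr ⟨i, ψ, fun Y _ => hψ Y⟩

/-- `K`-TYPED SEPARABLE protocols (label-PRIVATE steering with `K` steering types per player): at every
node the bit is a label test, or a test of ONE row whose index — and the test applied to it — depend on the
sender's labels only through a `K`-valued type `τA` (Alice) / `τB` (Bob). `K = 1` is `LabelPublic`. -/
def TypedSep (g : (Fin n → Bool) → Bool) {K : ℕ} (τA τB : (Fin m → Bool) → Fin K) :
    KWTree (Fin m × Fin n) → Prop
  | .leaf _ => True
  | .alice s P Q =>
      ((∃ φ : (Fin m → Bool) → Bool, ∀ X, s X = φ (rowLabels g X)) ∨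
        (∃ (ι : Fin K → Fin m) (ψ : Fin K → (Fin n → Bool) → Bool),
          ∀ X, s X = ψ (τA (rowLabels g X)) (row X (ι (τA (rowLabels g X)))))) ∧
      TypedSep g τA τB P ∧ TypedSep g τA τB Q
  | .bob s P Q =>
      ((∃ φ : (Fin m → Bool) → Bool, ∀ Y, s Y = φ (rowLabels g Y)) ∨
        (∃ (ι : Fin K → Fin m) (ψ : Fin K → (Fin n → Bool) → Bool),
          ∀ Y, s Y = ψ (τB (rowLabels g Y)) (row Y (ι (τB (rowLabels g Y)))))) ∧
      TypedSep g τA τB P ∧ TypedSep g τA τB Q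

/-- A typed-separable protocol is label-public on every type rectangle `τA⁻¹ t × τB⁻¹ t'`. -/
theorem TypedSep.labelPublicOn {g : (Fin n → Bool) → Bool} {K : ℕ} {τA τB : (Fin m → Bool) → Fin K}
    (t t' : Fin K) : ∀ {P : KWTree (Fin m × Fin n)}, TypedSep g τA τB P →
      LabelPublicOn g (τA ⁻¹' {t}) (τB ⁻¹' {t'}) P
  | .leaf _, _ => trivial
  | .alice s P Q, h => by
    have h' : ((∃ φ : (Fin m → Bool) → Bool, ∀ X, s X = φ (rowLabels g X)) ∨
        (∃ (ι : Fin K → Fin m) (ψ : Fin K → (Fin n → Bool) → Bool),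
          ∀ X, s X = ψ (τA (rowLabels g X)) (row X (ι (τA (rowLabels g X)))))) ∧
      TypedSep g τA τB P ∧ TypedSep g τA τB Q := h
    obtain ⟨hs, hP, hQ⟩ := h'
    show (_ ∨ _) ∧ _ ∧ _
    refine ⟨?_, TypedSep.labelPublicOn t t' hP, TypedSep.labelPublicOn t t' hQ⟩
    rcases hs with ⟨φ, hφ⟩ | ⟨ι, ψ, hψ⟩
    · exact Or.inl ⟨φ, fun X _ => hφ X⟩
    · refine Or.inr ⟨ι t, ψ t, fun X hX => ?_⟩
      have ht : τA (rowLabels g X) = t := hX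
      rw [hψ, ht]
  | .bob s P Q, h => by
    have h' : ((∃ φ : (Fin m → Bool) → Bool, ∀ Y, s Y = φ (rowLabels g Y)) ∨
        (∃ (ι : Fin K → Fin m) (ψ : Fin K → (Fin n → Bool) → Bool),
          ∀ Y, s Y = ψ (τB (rowLabels g Y)) (row Y (ι (τB (rowLabels g Y)))))) ∧
      TypedSep g τA τB P ∧ TypedSep g τA τB Q := h
    obtain ⟨hs, hP, hQ⟩ := h'
    show (_ ∨ _) ∧ _ ∧ _
    refine ⟨?_, TypedSep.labelPublicOn t t' hP, TypedSep.labelPublicOn t t' hQ⟩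
    rcases hs with ⟨φ, hφ⟩ | ⟨ι, ψ, hψ⟩
    · exact Or.inl ⟨φ, fun Y _ => hφ Y⟩
    · refine Or.inr ⟨ι t', ψ t', fun Y hY => ?_⟩
      have ht : τB (rowLabels g Y) = t' := hY
      rw [hψ, ht]

variable (g : (Fin n → Bool) → Bool)

/-- The matrices one player may still hold: label column in `A`, row `i` in `S i` for every `i`. -/
def XSet (A : Set (Fin m → Bool)) (S : Fin m → Set (Fin n → Bool)) : Set (Fin m × Fin n → Bool) :=
  {X | rowLabels g X ∈ A ∧ ∀ i, row X i ∈ S i}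

/-- The REALISABLE label columns: those of `A` every coordinate of which is the `g`-value of an allowed row. -/
def AE (A : Set (Fin m → Bool)) (S : Fin m → Set (Fin n → Bool)) : Set (Fin m → Bool) :=
  {a | a ∈ A ∧ ∀ i, ∃ x ∈ S i, g x = a i}

/-- One side of the row game of row `i` at orientation value `α`: allowed rows with `g`-value `α`. -/
def RA (S : Fin m → Set (Fin n → Bool)) (i : Fin m) (α : Bool) : Set (Fin n → Bool) :=
  S i ∩ {x | g x = α}

/-- Orientation `(i, α)` (final row `i` with `a_i = α`, `b_i = ¬α`) is still possible. -/
def Alive (A B : Set (Fin m → Bool)) (S T : Fin m → Set (Fin n → Bool)) (i : Fin m) (α : Bool) : Prop :=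
  (∃ a ∈ AE g A S, a i = α) ∧ (∃ b ∈ AE g B T, b i = !α)

/-- `1` if all vectors of `E` agree at coordinate `i` (in particular if `E = ∅`), else `0`. -/
noncomputable def cst (E : Set (Fin m → Bool)) (i : Fin m) : ℕ := by
  classical exact if ∃ v, ∀ a ∈ E, a i = v then 1 else 0

/-- `P` is correct for the strong game on all input pairs the state allows. -/
def ValidOn (P : KWTree (Fin m × Fin n)) (A B : Set (Fin m → Bool)) (S T : Fin m → Set (Fin n → Bool)) :
    Prop :=
  ∀ X ∈ XSet g A S, ∀ Y ∈ XSet g B T,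
    X (P.run X Y) ≠ Y (P.run X Y) ∧ rowLabels g X (P.run X Y).1 ≠ rowLabels g Y (P.run X Y).1

variable {g}

theorem cst_le_one (E : Set (Fin m → Bool)) (i : Fin m) : cst E i ≤ 1 := by
  unfold cst; split <;> simp

theorem cst_mono {E E' : Set (Fin m → Bool)} (h : E' ⊆ E) (i : Fin m) : cst E i ≤ cst E' i := by
  classical
  unfold cst
  by_cases hE : ∃ v, ∀ a ∈ E, a i = v
  · obtain ⟨v, hv⟩ := hE
    have hE' : ∃ v, ∀ a ∈ E', a i = v := ⟨v, fun a ha => hv a (h ha)⟩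
    rw [if_pos ⟨v, hv⟩, if_pos hE']
  · rw [if_neg hE]; exact Nat.zero_le _

theorem cst_eq_one {E : Set (Fin m → Bool)} {i : Fin m} {v : Bool} (h : ∀ a ∈ E, a i = v) : cst E i = 1 := by
  classical
  unfold cst; rw [if_pos ⟨v, h⟩]

theorem cst_eq_zero {E : Set (Fin m → Bool)} {i : Fin m} {a a' : Fin m → Bool} (ha : a ∈ E) (ha' : a' ∈ E)
    (h : a i ≠ a' i) : cst E i = 0 := by
  classical
  unfold cst
  rw [if_neg]
  rintro ⟨v, hv⟩
  exact h ((hv a ha).trans (hv a' ha').symm)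

theorem AE_subset {A : Set (Fin m → Bool)} {S : Fin m → Set (Fin n → Bool)} : AE g A S ⊆ A :=
  fun _ ha => ha.1

/-- Realising a label column by a matrix, with a prescribed row `i`. -/
theorem exists_X_row {A : Set (Fin m → Bool)} {S : Fin m → Set (Fin n → Bool)} {a : Fin m → Bool}
    (ha : a ∈ AE g A S) {i : Fin m} {x : Fin n → Bool} (hx : x ∈ S i) (hgx : g x = a i) :
    ∃ X ∈ XSet g A S, rowLabels g X = a ∧ row X i = x := by
  classical
  obtain ⟨haA, hreal⟩ := ha
  choose y hy using hreal
  have hlab : rowLabels g (setRow (ofRows y) i x) = a := by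
    funext i'
    by_cases h : i' = i
    · subst h; simp [hgx]
    · rw [rowLabels_apply, row_setRow_of_ne _ _ h, row_ofRows]; exact (hy i').2
  refine ⟨setRow (ofRows y) i x, ⟨by rw [hlab]; exact haA, fun i' => ?_⟩, hlab, row_setRow_self _ _ _⟩
  by_cases h : i' = i
  · subst h; simpa using hx
  · rw [row_setRow_of_ne _ _ h, row_ofRows]; exact (hy i').1

/-- Realising a label column by a matrix. -/
theorem exists_X {A : Set (Fin m → Bool)} {S : Fin m → Set (Fin n → Bool)} {a : Fin m → Bool}
    (ha : a ∈ AE g A S) (i : Fin m) : ∃ X ∈ XSet g A S, rowLabels g X = a := by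
  obtain ⟨x, hx, hgx⟩ := ha.2 i
  obtain ⟨X, hX, hlab, -⟩ := exists_X_row ha hx hgx
  exact ⟨X, hX, hlab⟩

theorem Alive.mono {A A' B B' : Set (Fin m → Bool)} {S S' T T' : Fin m → Set (Fin n → Bool)} {i : Fin m}
    {α : Bool} (h : Alive g A' B' S' T' i α) (hA : AE g A' S' ⊆ AE g A S) (hB : AE g B' T' ⊆ AE g B T) :
    Alive g A B S T i α :=
  ⟨h.1.imp fun _ ⟨ha, hai⟩ => ⟨hA ha, hai⟩, h.2.imp fun _ ⟨hb, hbi⟩ => ⟨hB hb, hbi⟩⟩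

/-! ### Child states -/

/-- Label test: intersect the label set. -/
theorem XSet_inter_label (A : Set (Fin m → Bool)) (S : Fin m → Set (Fin n → Bool))
    (φ : (Fin m → Bool) → Bool) (β : Bool) :
    XSet g (A ∩ {a | φ a = β}) S = XSet g A S ∩ {X | φ (rowLabels g X) = β} := by
  ext X; simp only [XSet, Set.mem_setOf_eq, Set.mem_inter_iff]; tauto

theorem AE_inter_label (A : Set (Fin m → Bool)) (S : Fin m → Set (Fin n → Bool))
    (φ : (Fin m → Bool) → Bool) (β : Bool) :
    AE g (A ∩ {a | φ a = β}) S = AE g A S ∩ {a | φ a = β} := by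
  ext a; simp only [AE, Set.mem_setOf_eq, Set.mem_inter_iff]; tauto

/-- Row test on row `i` with bit `ψ`, answer `β`: shrink `S i`. -/
def rowChild (S : Fin m → Set (Fin n → Bool)) (i : Fin m) (ψ : (Fin n → Bool) → Bool) (β : Bool) :
    Fin m → Set (Fin n → Bool) :=
  Function.update S i (S i ∩ {x | ψ x = β})

theorem rowChild_self (S : Fin m → Set (Fin n → Bool)) (i : Fin m) (ψ : (Fin n → Bool) → Bool) (β : Bool) :
    rowChild S i ψ β i = S i ∩ {x | ψ x = β} := by
  simp [rowChild]

theorem rowChild_of_ne (S : Fin m → Set (Fin n → Bool)) {i i' : Fin m} (ψ : (Fin n → Bool) → Bool)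
    (β : Bool) (h : i' ≠ i) : rowChild S i ψ β i' = S i' := by
  simp [rowChild, h]

theorem rowChild_subset (S : Fin m → Set (Fin n → Bool)) (i : Fin m) (ψ : (Fin n → Bool) → Bool)
    (β : Bool) (i' : Fin m) : rowChild S i ψ β i' ⊆ S i' := by
  by_cases h : i' = i
  · subst h; rw [rowChild_self]; exact Set.inter_subset_left
  · rw [rowChild_of_ne _ _ _ h]

theorem XSet_rowChild (A : Set (Fin m → Bool)) (S : Fin m → Set (Fin n → Bool)) (i : Fin m)
    (ψ : (Fin n → Bool) → Bool) (β : Bool) :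
    XSet g A (rowChild S i ψ β) = XSet g A S ∩ {X | ψ (row X i) = β} := by
  ext X
  simp only [XSet, Set.mem_setOf_eq, Set.mem_inter_iff]
  constructor
  · rintro ⟨hA, hS⟩
    have hi := hS i
    rw [rowChild_self] at hi
    exact ⟨⟨hA, fun i' => rowChild_subset S i ψ β i' (hS i')⟩, hi.2⟩
  · rintro ⟨⟨hA, hS⟩, hψ⟩
    refine ⟨hA, fun i' => ?_⟩
    by_cases h : i' = i
    · subst h; rw [rowChild_self]; exact ⟨hS i', hψ⟩
    · rw [rowChild_of_ne _ _ _ h]; exact hS i'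

/-- The part of the row game of `(i, α)` surviving the answer `β`. -/
theorem RA_rowChild_self (S : Fin m → Set (Fin n → Bool)) (i : Fin m) (ψ : (Fin n → Bool) → Bool)
    (β α : Bool) : RA g (rowChild S i ψ β) i α = RA g S i α ∩ {x | ψ x = β} := by
  ext x; simp only [RA, rowChild_self, Set.mem_inter_iff, Set.mem_setOf_eq]; tauto

theorem RA_rowChild_of_ne (S : Fin m → Set (Fin n → Bool)) {i i' : Fin m} (ψ : (Fin n → Bool) → Bool)
    (β α : Bool) (h : i' ≠ i) : RA g (rowChild S i ψ β) i' α = RA g S i' α := by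
  simp only [RA, rowChild_of_ne _ _ _ h]

theorem AE_rowChild_subset (A : Set (Fin m → Bool)) (S : Fin m → Set (Fin n → Bool)) (i : Fin m)
    (ψ : (Fin n → Bool) → Bool) (β : Bool) : AE g A (rowChild S i ψ β) ⊆ AE g A S := by
  rintro a ⟨haA, hreal⟩
  exact ⟨haA, fun i' => (hreal i').imp fun x ⟨hx, hgx⟩ => ⟨rowChild_subset S i ψ β i' hx, hgx⟩⟩

/-- A realisable column stays realisable after the row answer iff its own part of row `i` survives. -/
theorem mem_AE_rowChild {A : Set (Fin m → Bool)} {S : Fin m → Set (Fin n → Bool)} {i : Fin m}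
    {ψ : (Fin n → Bool) → Bool} {β : Bool} {a : Fin m → Bool} (ha : a ∈ AE g A S)
    (hpart : (RA g S i (a i) ∩ {x | ψ x = β}).Nonempty) : a ∈ AE g A (rowChild S i ψ β) := by
  refine ⟨ha.1, fun i' => ?_⟩
  by_cases h : i' = i
  · subst h
    obtain ⟨x, ⟨hxS, hgx⟩, hψ⟩ := hpart
    exact ⟨x, by rw [rowChild_self]; exact ⟨hxS, hψ⟩, hgx⟩
  · rw [rowChild_of_ne _ _ _ h]; exact ha.2 i'

end Game

/-! ## §3  The adversary: the invariant `ℓ + K ≤ depth + 2` -/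

section Key

variable {m n : ℕ} {g : (Fin n → Bool) → Bool} {𝒜 ℬ : Set (Fin m → Bool)}

/-- The invariant proved for every label-public subtree `P`, over all adversary states
`(A, B, S, T)`: if `P` is correct on the state, the realisable label rectangle needs depth `ℓ`, every
alive orientation `(i, α)` has a row game needing depth `r i α`, and `K ≤ r i α + #(sides constant at i)`
for every alive orientation, then `ℓ + K ≤ depth P + 2`. -/
def InvOn (g : (Fin n → Bool) → Bool) (𝒜 ℬ : Set (Fin m → Bool)) (P : KWTree (Fin m × Fin n)) : Prop :=
  ∀ (A B : Set (Fin m → Bool)) (S T : Fin m → Set (Fin n → Bool)), A ⊆ 𝒜 → B ⊆ ℬ →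
    ValidOn g P A B S T → (∀ a ∈ AE g A S, ∀ b ∈ AE g B T, a ≠ b) →
    (AE g A S).Nonempty → (AE g B T).Nonempty →
    ∀ (ℓ K : ℕ) (r : Fin m → Bool → ℕ), Hard (AE g A S) (AE g B T) ℓ →
      (∀ i α, Alive g A B S T i α → Hard (RA g S i α) (RA g T i (!α)) (r i α)) →
      (∀ i α, Alive g A B S T i α → K ≤ r i α + cst (AE g A S) i + cst (AE g B T) i) →
      ℓ + K ≤ P.depth + 2

/-- LEAF: both the label rectangle and the row game of the output row are solved by leaves. -/
theorem inv_leaf (p : Fin m × Fin n) : InvOn g 𝒜 ℬ (KWTree.leaf p) := by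
  intro A B S T h𝒜 hℬ hV hD hneA hneB ℓ K r hL hR hK
  obtain ⟨i, j⟩ := p
  obtain ⟨a, ha⟩ := hneA
  obtain ⟨b, hb⟩ := hneB
  -- labels differ at `i` on the whole realisable rectangle
  have hdiff : ∀ a ∈ AE g A S, ∀ b ∈ AE g B T, a i ≠ b i := by
    intro a ha b hb
    obtain ⟨X, hX, hXa⟩ := exists_X ha i
    obtain ⟨Y, hY, hYb⟩ := exists_X hb i
    have h2 := (hV X hX Y hY).2
    simp only [KWTree.run_leaf] at h2
    rw [hXa, hYb] at h2
    exact h2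
  have hℓ : ℓ = 0 := hL.eq_zero_of_leaf (i := i) (fun a ha b hb => by simpa using hdiff a ha b hb)
  have hab : b i = !(a i) := by
    have := hdiff a ha b hb
    cases hai : a i <;> cases hbi : b i <;> simp_all
  have halive : Alive g A B S T i (a i) := ⟨⟨a, ha, rfl⟩, ⟨b, hb, hab⟩⟩
  have hr : r i (a i) = 0 := by
    refine (hR i (a i) halive).eq_zero_of_leaf (i := j) ?_
    intro x hx y hy
    obtain ⟨X, hX, -, hXi⟩ := exists_X_row ha hx.1 hx.2
    obtain ⟨Y, hY, -, hYi⟩ := exists_X_row hb hy.1 (hy.2.trans hab.symm)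
    have h1 := (hV X hX Y hY).1
    simp only [KWTree.run_leaf] at h1
    have hx' : X (i, j) = x j := by rw [← hXi]; rfl
    have hy' : Y (i, j) = y j := by rw [← hYi]; rfl
    simpa [hx', hy'] using h1
  have hk := hK i (a i) halive
  have h1 := cst_le_one (AE g A S) i
  have h2 := cst_le_one (AE g B T) i
  simp only [KWTree.depth_leaf]
  omega

/-- Which subtree the play enters on the bit `β`, with its invariant and depth bound (Alice node). -/
theorem alice_child {s : (Fin m × Fin n → Bool) → Bool} {P Q : KWTree (Fin m × Fin n)}
    (hIP : InvOn g 𝒜 ℬ P) (hIQ : InvOn g 𝒜 ℬ Q) (β : Bool) :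
    ∃ C : KWTree (Fin m × Fin n), InvOn g 𝒜 ℬ C ∧ C.depth ≤ max P.depth Q.depth ∧
      ∀ X Y, s X = β → (KWTree.alice s P Q).run X Y = C.run X Y := by
  cases β
  · exact ⟨P, hIP, le_max_left _ _, fun X Y h => by simp [h]⟩
  · exact ⟨Q, hIQ, le_max_right _ _, fun X Y h => by simp [h]⟩

/-- Which subtree the play enters on the bit `β` (Bob node). -/
theorem bob_child {s : (Fin m × Fin n → Bool) → Bool} {P Q : KWTree (Fin m × Fin n)}
    (hIP : InvOn g 𝒜 ℬ P) (hIQ : InvOn g 𝒜 ℬ Q) (β : Bool) :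
    ∃ C : KWTree (Fin m × Fin n), InvOn g 𝒜 ℬ C ∧ C.depth ≤ max P.depth Q.depth ∧
      ∀ X Y, s Y = β → (KWTree.bob s P Q).run X Y = C.run X Y := by
  cases β
  · exact ⟨P, hIP, le_max_left _ _, fun X Y h => by simp [h]⟩
  · exact ⟨Q, hIQ, le_max_right _ _, fun X Y h => by simp [h]⟩

/-- ALICE LABEL TEST: `ℓ` drops by at most one (subadditivity), `K` is kept. -/
theorem label_step_alice {s : (Fin m × Fin n → Bool) → Bool} {P Q : KWTree (Fin m × Fin n)}
    {φ : (Fin m → Bool) → Bool} (hφ : ∀ X, rowLabels g X ∈ 𝒜 → s X = φ (rowLabels g X)) (hIP : InvOn g 𝒜 ℬ P) (hIQ : InvOn g 𝒜 ℬ Q)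
    (i₀ : Fin m) : InvOn g 𝒜 ℬ (KWTree.alice s P Q) := by
  intro A B S T h𝒜 hℬ hV hD hneA hneB ℓ K r hL hR hK
  obtain ⟨β, hne, hH⟩ := hL.split_alice hneA i₀ φ
  obtain ⟨C, hIC, hCd, hrun⟩ := alice_child (s := s) hIP hIQ β
  set A' : Set (Fin m → Bool) := A ∩ {a | φ a = β} with hA'
  have hAE : AE g A' S = AE g A S ∩ {a | φ a = β} := AE_inter_label A S φ β
  have hsub : AE g A' S ⊆ AE g A S := by rw [hAE]; exact Set.inter_subset_left
  have hV' : ValidOn g C A' B S T := by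
    intro X hX Y hY
    rw [hA', XSet_inter_label] at hX
    have hsX : s X = β := by rw [hφ X (h𝒜 hX.1.1)]; exact hX.2
    have := hV X hX.1 Y hY
    rwa [hrun X Y hsX] at this
  have hD' : ∀ a ∈ AE g A' S, ∀ b ∈ AE g B T, a ≠ b := fun a ha b hb => hD a (hsub ha) b hb
  have hneA' : (AE g A' S).Nonempty := by rw [hAE]; exact hne
  have hL' : Hard (AE g A' S) (AE g B T) (ℓ - 1) := by rw [hAE]; exact hH
  have hR' : ∀ i α, Alive g A' B S T i α → Hard (RA g S i α) (RA g T i (!α)) (r i α) :=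
    fun i α h => hR i α (h.mono hsub fun _ hb => hb)
  have hK' : ∀ i α, Alive g A' B S T i α → K ≤ r i α + cst (AE g A' S) i + cst (AE g B T) i := by
    intro i α h
    have hk := hK i α (h.mono hsub fun _ hb => hb)
    have hc := cst_mono hsub i
    omega
  have := hIC A' B S T (fun a ha => h𝒜 ha.1) hℬ hV' hD' hneA' hneB (ℓ - 1) K r hL' hR' hK'
  simp only [KWTree.depth_alice]
  omega

/-- BOB LABEL TEST. -/
theorem label_step_bob {s : (Fin m × Fin n → Bool) → Bool} {P Q : KWTree (Fin m × Fin n)}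
    {φ : (Fin m → Bool) → Bool} (hφ : ∀ Y, rowLabels g Y ∈ ℬ → s Y = φ (rowLabels g Y)) (hIP : InvOn g 𝒜 ℬ P) (hIQ : InvOn g 𝒜 ℬ Q)
    (i₀ : Fin m) : InvOn g 𝒜 ℬ (KWTree.bob s P Q) := by
  intro A B S T h𝒜 hℬ hV hD hneA hneB ℓ K r hL hR hK
  obtain ⟨β, hne, hH⟩ := hL.split_bob hneB i₀ φ
  obtain ⟨C, hIC, hCd, hrun⟩ := bob_child (s := s) hIP hIQ β
  set B' : Set (Fin m → Bool) := B ∩ {b | φ b = β} with hB'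
  have hAE : AE g B' T = AE g B T ∩ {b | φ b = β} := AE_inter_label B T φ β
  have hsub : AE g B' T ⊆ AE g B T := by rw [hAE]; exact Set.inter_subset_left
  have hV' : ValidOn g C A B' S T := by
    intro X hX Y hY
    rw [hB', XSet_inter_label] at hY
    have hsY : s Y = β := by rw [hφ Y (hℬ hY.1.1)]; exact hY.2
    have := hV X hX Y hY.1
    rwa [hrun X Y hsY] at this
  have hD' : ∀ a ∈ AE g A S, ∀ b ∈ AE g B' T, a ≠ b := fun a ha b hb => hD a ha b (hsub hb)
  have hneB' : (AE g B' T).Nonempty := by rw [hAE]; exact hne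
  have hL' : Hard (AE g A S) (AE g B' T) (ℓ - 1) := by rw [hAE]; exact hH
  have hR' : ∀ i α, Alive g A B' S T i α → Hard (RA g S i α) (RA g T i (!α)) (r i α) :=
    fun i α h => hR i α (h.mono (fun _ ha => ha) hsub)
  have hK' : ∀ i α, Alive g A B' S T i α → K ≤ r i α + cst (AE g A S) i + cst (AE g B' T) i := by
    intro i α h
    have hk := hK i α (h.mono (fun _ ha => ha) hsub)
    have hc := cst_mono hsub i
    omega
  have := hIC A B' S T h𝒜 (fun b hb => hℬ hb.1) hV' hD' hneA hneB' (ℓ - 1) K r hL' hR' hK'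
  simp only [KWTree.depth_bob]
  omega

/-- ALICE PUBLIC ROW TEST on row `i`: either one answer keeps every realisable orientation of row `i`
undamaged (then only `K` drops by one), or the adversary fixes Alice's label `a_i` (costing `ℓ` at most one)
and follows an answer undamaged for the surviving orientation, whose constant-side count goes up by one. -/
theorem row_step_alice {s : (Fin m × Fin n → Bool) → Bool} {P Q : KWTree (Fin m × Fin n)} {i : Fin m}
    {ψ : (Fin n → Bool) → Bool} (hψ : ∀ X, rowLabels g X ∈ 𝒜 → s X = ψ (row X i)) (hIP : InvOn g 𝒜 ℬ P) (hIQ : InvOn g 𝒜 ℬ Q)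
    (i₀ : Fin m) (j₀ : Fin n) : InvOn g 𝒜 ℬ (KWTree.alice s P Q) := by
  classical
  intro A B S T h𝒜 hℬ hV hD hneA hneB ℓ K r hL hR hK
  -- `Good β α`: after the answer `β` the Alice part of the row game `(i, α)` is nonempty and (if the
  -- orientation is alive) still needs depth `r i α - 1`.
  let Good : Bool → Bool → Prop := fun β α =>
    (RA g S i α ∩ {x | ψ x = β}).Nonempty ∧
      (Alive g A B S T i α → Hard (RA g S i α ∩ {x | ψ x = β}) (RA g T i (!α)) (r i α - 1))
  have G : ∀ α, (∃ a ∈ AE g A S, a i = α) → ∃ β, Good β α := by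
    rintro α ⟨a, ha, hai⟩
    obtain ⟨x, hx, hgx⟩ := ha.2 i
    have hxα : x ∈ RA g S i α := ⟨hx, by rw [Set.mem_setOf_eq, hgx, hai]⟩
    by_cases hal : Alive g A B S T i α
    · obtain ⟨β, hβne, hβH⟩ := (hR i α hal).split_alice ⟨x, hxα⟩ j₀ ψ
      exact ⟨β, hβne, fun _ => hβH⟩
    · exact ⟨ψ x, ⟨x, hxα, rfl⟩, fun h => (hal h).elim⟩
  by_cases hA : ∃ β, ∀ α, (∃ a ∈ AE g A S, a i = α) → Good β α
  · -- CASE A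
    obtain ⟨β, hgood⟩ := hA
    obtain ⟨C, hIC, hCd, hrun⟩ := alice_child (s := s) hIP hIQ β
    set S' := rowChild S i ψ β with hS'
    have hAE : AE g A S' = AE g A S := by
      refine Set.Subset.antisymm (AE_rowChild_subset A S i ψ β) fun a ha => ?_
      exact mem_AE_rowChild ha (hgood (a i) ⟨a, ha, rfl⟩).1
    have hV' : ValidOn g C A B S' T := by
      intro X hX Y hY
      rw [hS', XSet_rowChild] at hX
      have hsX : s X = β := by rw [hψ X (h𝒜 hX.1.1)]; exact hX.2
      have := hV X hX.1 Y hY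
      rwa [hrun X Y hsX] at this
    have hD' : ∀ a ∈ AE g A S', ∀ b ∈ AE g B T, a ≠ b := by rw [hAE]; exact hD
    have hneA' : (AE g A S').Nonempty := by rw [hAE]; exact hneA
    have hL' : Hard (AE g A S') (AE g B T) ℓ := by rw [hAE]; exact hL
    let r' : Fin m → Bool → ℕ := fun i' α => if i' = i then r i α - 1 else r i' α
    have hR' : ∀ i' α, Alive g A B S' T i' α → Hard (RA g S' i' α) (RA g T i' (!α)) (r' i' α) := by
      intro i' α hal
      have hal0 : Alive g A B S T i' α := hal.mono (by rw [hAE]) (fun _ h => h)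
      by_cases h : i' = i
      · subst h
        have hr' : r' i' α = r i' α - 1 := by simp [r']
        rw [hr', hS', RA_rowChild_self]
        exact (hgood α hal0.1).2 hal0
      · have hr' : r' i' α = r i' α := by simp [r', h]
        rw [hr', hS', RA_rowChild_of_ne _ _ _ _ h]
        exact hR i' α hal0
    have hK' : ∀ i' α, Alive g A B S' T i' α →
        K - 1 ≤ r' i' α + cst (AE g A S') i' + cst (AE g B T) i' := by
      intro i' α hal
      have hal0 : Alive g A B S T i' α := hal.mono (by rw [hAE]) (fun _ h => h)
      have hk := hK i' α hal0
      rw [hAE]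
      by_cases h : i' = i
      · subst h
        have hr' : r' i' α = r i' α - 1 := by simp [r']
        rw [hr']; omega
      · have hr' : r' i' α = r i' α := by simp [r', h]
        rw [hr']; omega
    have := hIC A B S' T h𝒜 hℬ hV' hD' hneA' hneB ℓ (K - 1) r' hL' hR' hK'
    simp only [KWTree.depth_alice]
    omega
  · -- CASE B
    have hA' : ∀ β, ∃ α, (∃ a ∈ AE g A S, a i = α) ∧ ¬ Good β α := by
      intro β
      by_contra hcon
      exact hA ⟨β, fun α hα => by by_contra hbad; exact hcon ⟨α, hα, hbad⟩⟩
    obtain ⟨v, hne, hH⟩ := hL.split_alice hneA i₀ (fun a => a i)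
    obtain ⟨a₁, ha₁, ha₁i⟩ := hne
    have ha₁i : a₁ i = v := ha₁i
    obtain ⟨β, hβne, hβH⟩ := G v ⟨a₁, ha₁, ha₁i⟩
    obtain ⟨α₂, ⟨a₂, ha₂, ha₂i⟩, hbad⟩ := hA' β
    have hα₂ : α₂ ≠ v := by rintro rfl; exact hbad ⟨hβne, hβH⟩
    have hcst0 : cst (AE g A S) i = 0 :=
      cst_eq_zero ha₁ ha₂ (by rw [ha₁i, ha₂i]; exact Ne.symm hα₂)
    obtain ⟨C, hIC, hCd, hrun⟩ := alice_child (s := s) hIP hIQ β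
    set S' := rowChild S i ψ β with hS'
    set A' : Set (Fin m → Bool) := A ∩ {a | a i = v} with hA'def
    have hAE : AE g A' S' = AE g A S ∩ {a | a i = v} := by
      ext a
      constructor
      · intro ha
        have ha0 : a ∈ AE g A S' := ⟨ha.1.1, ha.2⟩
        exact ⟨AE_rowChild_subset A S i ψ β ha0, ha.1.2⟩
      · rintro ⟨ha, hai⟩
        have hai : a i = v := hai
        have h' := mem_AE_rowChild (ψ := ψ) (β := β) ha (by rw [hai]; exact hβne)
        exact ⟨⟨ha.1, hai⟩, h'.2⟩
    have hsub : AE g A' S' ⊆ AE g A S := by rw [hAE]; exact Set.inter_subset_left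
    have hV' : ValidOn g C A' B S' T := by
      intro X hX Y hY
      have hX0 : X ∈ XSet g A S' := ⟨hX.1.1, hX.2⟩
      rw [hS', XSet_rowChild] at hX0
      have hsX : s X = β := by rw [hψ X (h𝒜 hX0.1.1)]; exact hX0.2
      have := hV X hX0.1 Y hY
      rwa [hrun X Y hsX] at this
    have hD' : ∀ a ∈ AE g A' S', ∀ b ∈ AE g B T, a ≠ b := fun a ha b hb => hD a (hsub ha) b hb
    have hneA' : (AE g A' S').Nonempty := by rw [hAE]; exact ⟨a₁, ha₁, ha₁i⟩
    have hL' : Hard (AE g A' S') (AE g B T) (ℓ - 1) := by rw [hAE]; exact hH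
    let r' : Fin m → Bool → ℕ := fun i' α => if i' = i then r i α - 1 else r i' α
    have hR' : ∀ i' α, Alive g A' B S' T i' α → Hard (RA g S' i' α) (RA g T i' (!α)) (r' i' α) := by
      intro i' α hal
      have hal0 : Alive g A B S T i' α := hal.mono hsub (fun _ h => h)
      by_cases h : i' = i
      · subst h
        obtain ⟨⟨a, ha, hai⟩, -⟩ := hal
        rw [hAE] at ha
        have hαv : α = v := by rw [← hai]; exact ha.2
        subst hαv
        have hr' : r' i' α = r i' α - 1 := by simp [r']
        rw [hr', hS', RA_rowChild_self]
        exact hβH hal0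
      · have hr' : r' i' α = r i' α := by simp [r', h]
        rw [hr', hS', RA_rowChild_of_ne _ _ _ _ h]
        exact hR i' α hal0
    have hK' : ∀ i' α, Alive g A' B S' T i' α →
        K ≤ r' i' α + cst (AE g A' S') i' + cst (AE g B T) i' := by
      intro i' α hal
      have hal0 : Alive g A B S T i' α := hal.mono hsub (fun _ h => h)
      have hk := hK i' α hal0
      have hc := cst_mono hsub i'
      by_cases h : i' = i
      · subst h
        obtain ⟨⟨a, ha, hai⟩, -⟩ := hal
        rw [hAE] at ha
        have hαv : α = v := by rw [← hai]; exact ha.2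
        subst hαv
        have hr' : r' i' α = r i' α - 1 := by simp [r']
        have hc1 : cst (AE g A' S') i' = 1 := cst_eq_one (v := α) (fun a' ha' => by
          rw [hAE] at ha'; exact ha'.2)
        rw [hr', hc1]
        rw [hcst0] at hk
        omega
      · have hr' : r' i' α = r i' α := by simp [r', h]
        rw [hr']; omega
    have := hIC A' B S' T (fun a ha => h𝒜 ha.1) hℬ hV' hD' hneA' hneB (ℓ - 1) K r' hL' hR' hK'
    simp only [KWTree.depth_alice]
    omega

/-- BOB PUBLIC ROW TEST on row `i` (mirror image of `row_step_alice`). -/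
theorem row_step_bob {s : (Fin m × Fin n → Bool) → Bool} {P Q : KWTree (Fin m × Fin n)} {i : Fin m}
    {ψ : (Fin n → Bool) → Bool} (hψ : ∀ Y, rowLabels g Y ∈ ℬ → s Y = ψ (row Y i)) (hIP : InvOn g 𝒜 ℬ P) (hIQ : InvOn g 𝒜 ℬ Q)
    (i₀ : Fin m) (j₀ : Fin n) : InvOn g 𝒜 ℬ (KWTree.bob s P Q) := by
  classical
  intro A B S T h𝒜 hℬ hV hD hneA hneB ℓ K r hL hR hK
  let Good : Bool → Bool → Prop := fun β α =>
    (RA g T i (!α) ∩ {y | ψ y = β}).Nonempty ∧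
      (Alive g A B S T i α → Hard (RA g S i α) (RA g T i (!α) ∩ {y | ψ y = β}) (r i α - 1))
  have G : ∀ α, (∃ b ∈ AE g B T, b i = !α) → ∃ β, Good β α := by
    rintro α ⟨b, hb, hbi⟩
    obtain ⟨y, hy, hgy⟩ := hb.2 i
    have hyα : y ∈ RA g T i (!α) := ⟨hy, by rw [Set.mem_setOf_eq, hgy, hbi]⟩
    by_cases hal : Alive g A B S T i α
    · obtain ⟨β, hβne, hβH⟩ := (hR i α hal).split_bob ⟨y, hyα⟩ j₀ ψ
      exact ⟨β, hβne, fun _ => hβH⟩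
    · exact ⟨ψ y, ⟨y, hyα, rfl⟩, fun h => (hal h).elim⟩
  by_cases hA : ∃ β, ∀ α, (∃ b ∈ AE g B T, b i = !α) → Good β α
  · -- CASE A
    obtain ⟨β, hgood⟩ := hA
    obtain ⟨C, hIC, hCd, hrun⟩ := bob_child (s := s) hIP hIQ β
    set T' := rowChild T i ψ β with hT'
    have hAE : AE g B T' = AE g B T := by
      refine Set.Subset.antisymm (AE_rowChild_subset B T i ψ β) fun b hb => ?_
      have h1 := (hgood (!(b i)) ⟨b, hb, by simp⟩).1
      simp only [Bool.not_not] at h1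
      exact mem_AE_rowChild hb h1
    have hV' : ValidOn g C A B S T' := by
      intro X hX Y hY
      rw [hT', XSet_rowChild] at hY
      have hsY : s Y = β := by rw [hψ Y (hℬ hY.1.1)]; exact hY.2
      have := hV X hX Y hY.1
      rwa [hrun X Y hsY] at this
    have hD' : ∀ a ∈ AE g A S, ∀ b ∈ AE g B T', a ≠ b := by rw [hAE]; exact hD
    have hneB' : (AE g B T').Nonempty := by rw [hAE]; exact hneB
    have hL' : Hard (AE g A S) (AE g B T') ℓ := by rw [hAE]; exact hL
    let r' : Fin m → Bool → ℕ := fun i' α => if i' = i then r i α - 1 else r i' α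
    have hR' : ∀ i' α, Alive g A B S T' i' α → Hard (RA g S i' α) (RA g T' i' (!α)) (r' i' α) := by
      intro i' α hal
      have hal0 : Alive g A B S T i' α := hal.mono (fun _ h => h) (by rw [hAE])
      by_cases h : i' = i
      · subst h
        have hr' : r' i' α = r i' α - 1 := by simp [r']
        rw [hr', hT', RA_rowChild_self]
        exact (hgood α hal0.2).2 hal0
      · have hr' : r' i' α = r i' α := by simp [r', h]
        rw [hr', hT', RA_rowChild_of_ne _ _ _ _ h]
        exact hR i' α hal0
    have hK' : ∀ i' α, Alive g A B S T' i' α →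
        K - 1 ≤ r' i' α + cst (AE g A S) i' + cst (AE g B T') i' := by
      intro i' α hal
      have hal0 : Alive g A B S T i' α := hal.mono (fun _ h => h) (by rw [hAE])
      have hk := hK i' α hal0
      rw [hAE]
      by_cases h : i' = i
      · subst h
        have hr' : r' i' α = r i' α - 1 := by simp [r']
        rw [hr']; omega
      · have hr' : r' i' α = r i' α := by simp [r', h]
        rw [hr']; omega
    have := hIC A B S T' h𝒜 hℬ hV' hD' hneA hneB' ℓ (K - 1) r' hL' hR' hK'
    simp only [KWTree.depth_bob]
    omega
  · -- CASE B
    have hA' : ∀ β, ∃ α, (∃ b ∈ AE g B T, b i = !α) ∧ ¬ Good β α := by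
      intro β
      by_contra hcon
      exact hA ⟨β, fun α hα => by by_contra hbad; exact hcon ⟨α, hα, hbad⟩⟩
    obtain ⟨w, hne, hH⟩ := hL.split_bob hneB i₀ (fun b => b i)
    obtain ⟨b₁, hb₁, hb₁i⟩ := hne
    have hb₁i : b₁ i = w := hb₁i
    obtain ⟨β, hβne0, hβH0⟩ := G (!w) ⟨b₁, hb₁, by rw [hb₁i, Bool.not_not]⟩
    have hβne : (RA g T i w ∩ {y | ψ y = β}).Nonempty := by simpa only [Bool.not_not] using hβne0
    have hβH : Alive g A B S T i (!w) → Hard (RA g S i (!w)) (RA g T i w ∩ {y | ψ y = β}) (r i (!w) - 1) := by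
      simpa only [Bool.not_not] using hβH0
    obtain ⟨α₂, ⟨b₂, hb₂, hb₂i⟩, hbad⟩ := hA' β
    have hα₂ : α₂ ≠ !w := by rintro rfl; exact hbad ⟨hβne0, hβH0⟩
    have hcst0 : cst (AE g B T) i = 0 :=
      cst_eq_zero hb₁ hb₂ (by rw [hb₁i, hb₂i]; cases α₂ <;> cases w <;> simp_all)
    obtain ⟨C, hIC, hCd, hrun⟩ := bob_child (s := s) hIP hIQ β
    set T' := rowChild T i ψ β with hT'
    set B' : Set (Fin m → Bool) := B ∩ {b | b i = w} with hB'def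
    have hAE : AE g B' T' = AE g B T ∩ {b | b i = w} := by
      ext b
      constructor
      · intro hb
        have hb0 : b ∈ AE g B T' := ⟨hb.1.1, hb.2⟩
        exact ⟨AE_rowChild_subset B T i ψ β hb0, hb.1.2⟩
      · rintro ⟨hb, hbi⟩
        have hbi : b i = w := hbi
        have h' := mem_AE_rowChild (ψ := ψ) (β := β) hb (by rw [hbi]; exact hβne)
        exact ⟨⟨hb.1, hbi⟩, h'.2⟩
    have hsub : AE g B' T' ⊆ AE g B T := by rw [hAE]; exact Set.inter_subset_left
    have hV' : ValidOn g C A B' S T' := by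
      intro X hX Y hY
      have hY0 : Y ∈ XSet g B T' := ⟨hY.1.1, hY.2⟩
      rw [hT', XSet_rowChild] at hY0
      have hsY : s Y = β := by rw [hψ Y (hℬ hY0.1.1)]; exact hY0.2
      have := hV X hX Y hY0.1
      rwa [hrun X Y hsY] at this
    have hD' : ∀ a ∈ AE g A S, ∀ b ∈ AE g B' T', a ≠ b := fun a ha b hb => hD a ha b (hsub hb)
    have hneB' : (AE g B' T').Nonempty := by rw [hAE]; exact ⟨b₁, hb₁, hb₁i⟩
    have hL' : Hard (AE g A S) (AE g B' T') (ℓ - 1) := by rw [hAE]; exact hH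
    let r' : Fin m → Bool → ℕ := fun i' α => if i' = i then r i α - 1 else r i' α
    have hR' : ∀ i' α, Alive g A B' S T' i' α → Hard (RA g S i' α) (RA g T' i' (!α)) (r' i' α) := by
      intro i' α hal
      have hal0 : Alive g A B S T i' α := hal.mono (fun _ h => h) hsub
      by_cases h : i' = i
      · subst h
        obtain ⟨-, ⟨b, hb, hbi⟩⟩ := hal
        rw [hAE] at hb
        have hαw : α = !w := by
          have : b i' = w := hb.2
          rw [this] at hbi
          rw [hbi, Bool.not_not]
        subst hαw
        have hr' : r' i' (!w) = r i' (!w) - 1 := by simp [r']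
        rw [hr', Bool.not_not, hT', RA_rowChild_self]
        exact hβH hal0
      · have hr' : r' i' α = r i' α := by simp [r', h]
        rw [hr', hT', RA_rowChild_of_ne _ _ _ _ h]
        exact hR i' α hal0
    have hK' : ∀ i' α, Alive g A B' S T' i' α →
        K ≤ r' i' α + cst (AE g A S) i' + cst (AE g B' T') i' := by
      intro i' α hal
      have hal0 : Alive g A B S T i' α := hal.mono (fun _ h => h) hsub
      have hk := hK i' α hal0
      have hc := cst_mono hsub i'
      by_cases h : i' = i
      · subst h
        obtain ⟨-, ⟨b, hb, hbi⟩⟩ := hal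
        rw [hAE] at hb
        have hαw : α = !w := by
          have : b i' = w := hb.2
          rw [this] at hbi
          rw [hbi, Bool.not_not]
        subst hαw
        have hr' : r' i' (!w) = r i' (!w) - 1 := by simp [r']
        have hc1 : cst (AE g B' T') i' = 1 := cst_eq_one (v := w) (fun b' hb' => by
          rw [hAE] at hb'; exact hb'.2)
        rw [hr', hc1]
        rw [hcst0] at hk
        omega
      · have hr' : r' i' α = r i' α := by simp [r', h]
        rw [hr']; omega
    have := hIC A B' S T' h𝒜 (fun b hb => hℬ hb.1) hV' hD' hneA hneB' (ℓ - 1) K r' hL' hR' hK'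
    simp only [KWTree.depth_bob]
    omega

/-- **The adversary theorem**: every (relativised) label-public separable tree satisfies the invariant. -/
theorem inv_of_labelPublicOn (i₀ : Fin m) (j₀ : Fin n) :
    ∀ P : KWTree (Fin m × Fin n), LabelPublicOn g 𝒜 ℬ P → InvOn g 𝒜 ℬ P
  | .leaf p, _ => inv_leaf p
  | .alice s P Q, h => by
    have h' : ((∃ φ : (Fin m → Bool) → Bool, ∀ X, rowLabels g X ∈ 𝒜 → s X = φ (rowLabels g X)) ∨
        (∃ (i : Fin m) (ψ : (Fin n → Bool) → Bool), ∀ X, rowLabels g X ∈ 𝒜 → s X = ψ (row X i))) ∧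
      LabelPublicOn g 𝒜 ℬ P ∧ LabelPublicOn g 𝒜 ℬ Q := h
    obtain ⟨hs, hP, hQ⟩ := h'
    rcases hs with ⟨φ, hφ⟩ | ⟨i, ψ, hψ⟩
    · exact label_step_alice hφ (inv_of_labelPublicOn i₀ j₀ P hP) (inv_of_labelPublicOn i₀ j₀ Q hQ) i₀
    · exact row_step_alice hψ (inv_of_labelPublicOn i₀ j₀ P hP) (inv_of_labelPublicOn i₀ j₀ Q hQ) i₀ j₀
  | .bob s P Q, h => by
    have h' : ((∃ φ : (Fin m → Bool) → Bool, ∀ Y, rowLabels g Y ∈ ℬ → s Y = φ (rowLabels g Y)) ∨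
        (∃ (i : Fin m) (ψ : (Fin n → Bool) → Bool), ∀ Y, rowLabels g Y ∈ ℬ → s Y = ψ (row Y i))) ∧
      LabelPublicOn g 𝒜 ℬ P ∧ LabelPublicOn g 𝒜 ℬ Q := h
    obtain ⟨hs, hP, hQ⟩ := h'
    rcases hs with ⟨φ, hφ⟩ | ⟨i, ψ, hψ⟩
    · exact label_step_bob hφ (inv_of_labelPublicOn i₀ j₀ P hP) (inv_of_labelPublicOn i₀ j₀ Q hQ) i₀
    · exact row_step_bob hψ (inv_of_labelPublicOn i₀ j₀ P hP) (inv_of_labelPublicOn i₀ j₀ Q hQ) i₀ j₀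

end Key

/-! ## §4  The theorems: label-public separable protocols are compose-optimal; C1 for them -/

section Main

variable {m n : ℕ}

theorem AE_root {g : (Fin n → Bool) → Bool} (hg : ∀ α : Bool, ∃ x, g x = α) (A : Set (Fin m → Bool)) :
    AE g A (fun _ => Set.univ) = A := by
  ext a
  simp only [AE, Set.mem_setOf_eq, Set.mem_univ, true_and]
  exact ⟨fun h => h.1, fun h => ⟨h, fun i => hg (a i)⟩⟩

/-- The row protocol played on one row is label-public separable. -/
theorem labelPublic_onRow (g : (Fin n → Bool) → Bool) (i : Fin m) :
    ∀ R : KWTree (Fin n), LabelPublic g (KWTree.onRow (m := m) i R)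
  | .leaf j => trivial
  | .alice s P Q => by
    have hP := labelPublic_onRow g i P
    have hQ := labelPublic_onRow g i Q
    simp only [KWTree.onRow, KWTree.comap, LabelPublic] at hP hQ ⊢
    exact ⟨Or.inr ⟨i, s, fun X => rfl⟩, hP, hQ⟩
  | .bob s P Q => by
    have hP := labelPublic_onRow g i P
    have hQ := labelPublic_onRow g i Q
    simp only [KWTree.onRow, KWTree.comap, LabelPublic] at hP hQ ⊢
    exact ⟨Or.inr ⟨i, s, fun X => rfl⟩, hP, hQ⟩

/-- **The obvious protocol is label-public separable** (so the class is the natural home of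
"independent play", and the theorem below is tight up to three rounds: `depth_compose`). -/
theorem labelPublic_compose (g : (Fin n → Bool) → Bool) (R : KWTree (Fin n)) :
    ∀ Q : KWTree (Fin m), LabelPublic g (KWTree.compose g R Q)
  | .leaf i => by
    simp only [KWTree.compose, LabelPublic]
    exact ⟨Or.inr ⟨i, g, fun X => rfl⟩, labelPublic_onRow g i R.swap, labelPublic_onRow g i R⟩
  | .alice s P Q => by
    simp only [KWTree.compose, LabelPublic]
    exact ⟨Or.inl ⟨s, fun X => rfl⟩, labelPublic_compose g R P, labelPublic_compose g R Q⟩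
  | .bob s P Q => by
    simp only [KWTree.compose, LabelPublic]
    exact ⟨Or.inl ⟨s, fun X => rfl⟩, labelPublic_compose g R P, labelPublic_compose g R Q⟩

/-- **THE TYPED OBSTRUCTION, relativised form.**  On a label rectangle `A × B` (`A ⊆ 𝒜`, `B ⊆ ℬ`) on which
`P` is correct for the strong game and label-public separable, `C(A × B) + D(KW_g) ≤ D(P) + 2`:
every lower bound `ℓ` for the KW game on `A × B` and every lower bound `dg` for `KW_g` satisfy
`ℓ + dg ≤ P.depth + 2`.  [this file; adversary argument in the style of KarchmerWigderson1990 /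
EdmondsImpagliazzoRudichSgall1991] -/
theorem labelPublicOn_rect_bound {g : (Fin n → Bool) → Bool} (hm : 1 ≤ m) (hg : ∃ x y, g x ≠ g y)
    {𝒜 ℬ A B : Set (Fin m → Bool)} (hA𝒜 : A ⊆ 𝒜) (hBℬ : B ⊆ ℬ) (hAB : ∀ a ∈ A, ∀ b ∈ B, a ≠ b)
    (hA : A.Nonempty) (hB : B.Nonempty) {P : KWTree (Fin m × Fin n)} (hLP : LabelPublicOn g 𝒜 ℬ P)
    (hV : ∀ X Y, rowLabels g X ∈ A → rowLabels g Y ∈ B →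
      X (P.run X Y) ≠ Y (P.run X Y) ∧ rowLabels g X (P.run X Y).1 ≠ rowLabels g Y (P.run X Y).1)
    {ℓ dg : ℕ} (hℓ : Hard A B ℓ) (hdg : ∀ R : KWTree (Fin n), R.Solves g → dg ≤ R.depth) :
    ℓ + dg ≤ P.depth + 2 := by
  classical
  obtain ⟨x₀, y₀, hxy⟩ := hg
  have hgα : ∀ α : Bool, ∃ x, g x = α := by
    intro α
    by_cases hx : g x₀ = α
    · exact ⟨x₀, hx⟩
    · refine ⟨y₀, ?_⟩
      generalize hu : g x₀ = u at hx hxy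
      generalize hv : g y₀ = v at hxy ⊢
      cases α <;> cases u <;> cases v <;> simp_all
  have hne_xy : x₀ ≠ y₀ := fun h => hxy (by rw [h])
  obtain ⟨j₀, -⟩ : ∃ j : Fin n, x₀ j ≠ y₀ j := by
    by_contra h
    push Not at h
    exact hne_xy (funext h)
  let i₀ : Fin m := ⟨0, hm⟩
  let U : Fin m → Set (Fin n → Bool) := fun _ => Set.univ
  have hAE_A : AE g A U = A := AE_root hgα A
  have hAE_B : AE g B U = B := AE_root hgα B
  have hV' : ValidOn g P A B U U := fun X hX Y hY => hV X Y hX.1 hY.1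
  have hD : ∀ a ∈ AE g A U, ∀ b ∈ AE g B U, a ≠ b := by rw [hAE_A, hAE_B]; exact hAB
  have hneA : (AE g A U).Nonempty := by rw [hAE_A]; exact hA
  have hneB : (AE g B U).Nonempty := by rw [hAE_B]; exact hB
  have hL : Hard (AE g A U) (AE g B U) ℓ := by rw [hAE_A, hAE_B]; exact hℓ
  have hR : ∀ i α, Alive g A B U U i α → Hard (RA g U i α) (RA g U i (!α)) dg := by
    intro i α _ R hRsol
    cases α
    · have hsol : R.swap.Solves g := by
        intro a b ha hb
        rw [KWTree.run_swap]
        have := hRsol b ⟨Set.mem_univ _, hb⟩ a ⟨Set.mem_univ _, by simpa using ha⟩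
        exact fun h => this h.symm
      simpa using hdg R.swap hsol
    · exact hdg R fun a b ha hb => hRsol a ⟨Set.mem_univ _, ha⟩ b ⟨Set.mem_univ _, by simpa using hb⟩
  have hK : ∀ i α, Alive g A B U U i α → dg ≤ dg + cst (AE g A U) i + cst (AE g B U) i :=
    fun _ _ _ => by omega
  exact inv_of_labelPublicOn i₀ j₀ P hLP A B U U hA𝒜 hBℬ hV' hD hneA hneB ℓ dg (fun _ _ => dg) hL hR hK

/-- **THE TYPED OBSTRUCTION.**  A label-public separable protocol for `KW_f ⊛ KW_g` is at most two
rounds shorter than independent play: from it one extracts a `KW_f` protocol `Q` with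
`Q.depth + dg ≤ P.depth + 2` for every lower bound `dg` on the `KW_g`-depth of `g` — for EVERY
non-constant inner `g`, with no `log` slack (tight up to three rounds: `depth_compose`,
`labelPublic_compose`). -/
theorem exists_solves_of_labelPublic {f : (Fin m → Bool) → Bool} {g : (Fin n → Bool) → Bool}
    (hf : ∃ a b, f a ≠ f b) (hg : ∃ x y, g x ≠ g y) {P : KWTree (Fin m × Fin n)}
    (hLP : LabelPublic g P) (hP : P.SolvesStrong f g) {dg : ℕ}
    (hdg : ∀ R : KWTree (Fin n), R.Solves g → dg ≤ R.depth) :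
    ∃ Q : KWTree (Fin m), Q.Solves f ∧ Q.depth + dg ≤ P.depth + 2 := by
  classical
  obtain ⟨a₀, b₀, hab⟩ := hf
  have hm : 1 ≤ m := one_le_of_nonconst ⟨a₀, b₀, hab⟩
  have hexT : ∃ a, f a = true := by
    cases ha : f a₀
    · exact ⟨b₀, by cases hb : f b₀ <;> simp_all⟩
    · exact ⟨a₀, ha⟩
  have hexF : ∃ b, f b = false := by
    cases ha : f a₀
    · exact ⟨a₀, ha⟩
    · exact ⟨b₀, by cases hb : f b₀ <;> simp_all⟩
  -- the least depth of a `KW_f` protocol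
  have hex : ∃ d, ∃ Q : KWTree (Fin m), Q.Solves f ∧ Q.depth = d := by
    obtain ⟨R, hR, -⟩ := exists_solves_sendInput hm f
    exact ⟨R.depth, R, hR, rfl⟩
  obtain ⟨Q, hQ, hQd⟩ := Nat.find_spec hex
  refine ⟨Q, hQ, ?_⟩
  let A : Set (Fin m → Bool) := {a | f a = true}
  let B : Set (Fin m → Bool) := {b | f b = false}
  have hAB : ∀ a ∈ A, ∀ b ∈ B, a ≠ b := by
    intro a ha b hb hab'
    have ha' : f a = true := ha
    have hb' : f b = false := hb
    rw [hab', hb'] at ha'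
    exact Bool.false_ne_true ha'
  have hV : ∀ X Y, rowLabels g X ∈ A → rowLabels g Y ∈ B →
      X (P.run X Y) ≠ Y (P.run X Y) ∧ rowLabels g X (P.run X Y).1 ≠ rowLabels g Y (P.run X Y).1 := by
    intro X Y hX hY
    have hX1 : f (rowLabels g X) = true := hX
    have hY1 : f (rowLabels g Y) = false := hY
    exact hP X Y (by simpa using hX1) (by simpa using hY1)
  have hℓ : Hard A B (Nat.find hex) := by
    intro Q' hQ'
    have hsol : Q'.Solves f := fun a b ha hb => hQ' a ha b hb
    exact Nat.find_min' hex ⟨Q', hsol, rfl⟩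
  have key := labelPublicOn_rect_bound hm hg (Set.subset_univ A) (Set.subset_univ B) hAB hexT hexF
    (hLP.on Set.univ Set.univ) hV hℓ hdg
  rw [hQd]
  exact key

/-- **C1 for label-public separable protocols** — VERBATIM the crux `StrongComposition` with the one
extra hypothesis `LabelPublic g P` (constant `c₀ + 2`, `c₀` from `DepthHardFunctionsExist_holds`; the
inner `g` is the Riordan–Shannon-hard function, or a dictator when `n` is tiny). -/
theorem strongComposition_labelPublic :
    ∃ c : ℕ, ∀ m n : ℕ, 1 ≤ n → ∀ f : (Fin m → Bool) → Bool, (∃ a b, f a ≠ f b) →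
      ∃ g : (Fin n → Bool) → Bool, ∀ P : KWTree (Fin m × Fin n), LabelPublic g P →
        P.SolvesStrong f g → ∃ Q : KWTree (Fin m), Q.Solves f ∧
          Q.depth + n ≤ P.depth + c * (Nat.log 2 (m * n) + 1) := by
  obtain ⟨c₀, hc₀⟩ := DepthHardFunctionsExist_holds
  refine ⟨c₀ + 2, fun m n hn f hf => ?_⟩
  obtain ⟨g, hg⟩ := hc₀ n hn
  have hm : 1 ≤ m := one_le_of_nonconst hf
  have hlog : Nat.log 2 n ≤ Nat.log 2 (m * n) := Nat.log_mono_right (Nat.le_mul_of_pos_left n hm)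
  have h1 : c₀ * (Nat.log 2 n + 1) ≤ c₀ * (Nat.log 2 (m * n) + 1) := Nat.mul_le_mul_left _ (by omega)
  have h2 : (c₀ + 2) * (Nat.log 2 (m * n) + 1) =
      c₀ * (Nat.log 2 (m * n) + 1) + 2 * (Nat.log 2 (m * n) + 1) := by ring
  by_cases hgc : ∃ x y, g x ≠ g y
  · refine ⟨g, fun P hLP hP => ?_⟩
    obtain ⟨Q, hQ, hQd⟩ := exists_solves_of_labelPublic hf hgc hLP hP
      (dg := n - c₀ * (Nat.log 2 n + 1)) (fun R hR => by have := hg R hR; omega)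
    refine ⟨Q, hQ, ?_⟩
    rw [h2]
    omega
  · push Not at hgc
    have hsmall : n ≤ c₀ * (Nat.log 2 n + 1) := by
      have := hg (KWTree.leaf ⟨0, hn⟩) (fun a b ha hb => by rw [hgc a b] at ha; simp_all)
      simpa using this
    refine ⟨fun x => x ⟨0, hn⟩, fun P hLP hP => ?_⟩
    have hg' : ∃ x y : Fin n → Bool, (fun x : Fin n → Bool => x ⟨0, hn⟩) x ≠ (fun x => x ⟨0, hn⟩) y :=
      ⟨fun _ => true, fun _ => false, by simp⟩
    obtain ⟨Q, hQ, hQd⟩ := exists_solves_of_labelPublic hf hg' hLP hP (dg := 0)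
      (fun R _ => Nat.zero_le _)
    refine ⟨Q, hQ, ?_⟩
    rw [h2]
    omega

/-- **Private steering with `K` types buys at most `2⌈log₂ K⌉ + 2` rounds.**  A `K`-typed separable
protocol for `KW_f ⊛ KW_g` is compose-optimal ON EVERY TYPE RECTANGLE: for all types `t, t'`,
`C((f⁻¹1 ∩ τA⁻¹t) × (f⁻¹0 ∩ τB⁻¹t')) + D(KW_g) ≤ D(P) + 2`.  Since
`C(KW_f) ≤ 2⌈log₂ K⌉ + max_{t,t'} C(type rectangle)` (the players announce their types), the savings of a
`K`-typed protocol over independent play are `≤ 2⌈log₂ K⌉ + 2`: an `ω(log mn)` counterexample to C1 by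
single-row tests needs `(mn)^{ω(1)}` effective steering types (memo §3). -/
theorem typedSep_rect_bound {f : (Fin m → Bool) → Bool} {g : (Fin n → Bool) → Bool}
    (hm : 1 ≤ m) (hg : ∃ x y, g x ≠ g y) {K : ℕ} {τA τB : (Fin m → Bool) → Fin K}
    {P : KWTree (Fin m × Fin n)} (hTP : TypedSep g τA τB P) (hP : P.SolvesStrong f g) (t t' : Fin K)
    (hA : ({a | f a = true} ∩ τA ⁻¹' {t}).Nonempty) (hB : ({b | f b = false} ∩ τB ⁻¹' {t'}).Nonempty)
    {ℓ dg : ℕ} (hℓ : Hard ({a | f a = true} ∩ τA ⁻¹' {t}) ({b | f b = false} ∩ τB ⁻¹' {t'}) ℓ)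
    (hdg : ∀ R : KWTree (Fin n), R.Solves g → dg ≤ R.depth) :
    ℓ + dg ≤ P.depth + 2 := by
  refine labelPublicOn_rect_bound hm hg Set.inter_subset_right Set.inter_subset_right ?_ hA hB
    (hTP.labelPublicOn t t') ?_ hℓ hdg
  · rintro a ⟨ha, -⟩ b ⟨hb, -⟩ hab
    have ha' : f a = true := ha
    have hb' : f b = false := hb
    rw [hab, hb'] at ha'
    exact Bool.false_ne_true ha'
  · rintro X Y ⟨hX, -⟩ ⟨hY, -⟩
    have hX1 : f (rowLabels g X) = true := hX
    have hY1 : f (rowLabels g Y) = false := hY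
    exact hP X Y (by simpa using hX1) (by simpa using hY1)

end Main



end Summit.PneNP.PneNP.Cruxes.StrongComposition.LabelPublic
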